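import Summits.NavierStokesRegularity.FunctionalMining.VorticityL4Pointwise
import Literature.Analysis.FluidPDE.TorusWeightedVorticityBalanceC1
import Literature.Analysis.FluidPDE.TorusVorticitySqTransport
import HarnessLib

/-!
# FunctionalMining — the `Z_q` balance for REAL `q > 2`: `Ż_q ≤ q∫|ω|^{q−2}σ − qν∫|ω|^{q−2}|∇ω|²`

Search for candidate a priori estimates; no regularity claim. Cell `pub-nsfunc`, prove seat
(gen 9). Toward the K0 rows `E.q|T_LD|G1` at real `q` (SIEVELD §3.2). The tree's `C¹`-weight
balance (`IsClassicalNSSolutionOn.hasDerivWithinAt_integral_torusVorticitySqAt_rpow_unforced`,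
Gibbon 2010 App. A, real `q ≥ 2`) gives `d/dt Z_q = q∫(|ω|²)^{q/2−1}σ + (q/2)ν∫(|ω|²)^{q/2−1}∑ᵢⱼWᵢⱼΔWᵢⱼ`
with the viscous term NOT integrated by parts (the weight `s^{q/2−1}` is not smooth at `0`). This
file supplies the sign of the viscous term for every real exponent `r = q/2 − 1 > 0`:

`∫ (|ω|²)^r ∑ᵢⱼ WᵢⱼΔWᵢⱼ ≤ −∫ (|ω|²)^r ∑ₖ∑ᵢⱼ (∂ₖWᵢⱼ)²`

(for smooth `v` on `T^d`), by applying the tree's SMOOTH-weight identity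
`integral_deriv_comp_mul_sum_mul_laplacian_torusVorticityTensor` to `g_ε(s) = (s+ε)^{r+1}/(r+1)`
(`g_ε' = (s+ε)^r`, `g_ε'' = r(s+ε)^{r−1} ≥ 0`) and letting `ε → 0⁺` through the continuity of the
parametric integrals. On `T³` (`∑ₖ∑ᵢⱼ(∂ₖWᵢⱼ)² = 2∑ₖ‖∂ₖ curl v‖²`) this yields the slice form
`Ż_q ≤ qX_q − qνI_q`, `X_q = ∫(|ω|²)^{q/2−1}σ`, `I_q = ∫‖ω‖^{q−2}∑ₖ‖∂ₖω‖²`, `ω = curl u`.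

## Main statements

* `integral_rpow_mul_sum_mul_laplacian_le` — the viscous sign at a real exponent (any `T^d`).
* `derivWithin_Zq_le` — the slice form of the `Z_q` balance on `T³`, real `q > 2`.
-/

noncomputable section

open MeasureTheory Finset Set Filter
open scoped InnerProductSpace RealInnerProductSpace ContDiff Topology

namespace Summit.NavierStokesRegularity.FunctionalMining

open Literature.Analysis.FunctionSpaces Literature.Analysis.FunctionSpaces.Torus
  Literature.Analysis.FluidPDE

namespace VorticityMoment

open VorticityL4

variable {d : Type*} [Fintype d] [DecidableEq d]

/-! ## 1. Parametric continuity (local copy of the `NonlinearPoincare` tool) -/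

omit [DecidableEq d] in
/-- Continuity of `ε ↦ ∫_{T^d} F(ε, x) dx` for jointly continuous `F`. [folklore] -/
private theorem continuous_integral_param' {F : ℝ → UnitAddTorus d → ℝ}
    (hF : Continuous (Function.uncurry F)) : Continuous fun ε => ∫ x, F ε x := by
  have h := continuous_parametric_integral_of_continuous (μ := volume) hF isCompact_univ
  simpa only [Measure.restrict_univ] using h

omit [Fintype d] [DecidableEq d] in
/-- Passing to `ε → 0⁺` in `0 ≤ φ ε` (`0 < ε ≤ 1`) with `φ` continuous at `0`. [folklore] -/
private theorem nonneg_of_forall_pos_of_continuousAt {φ : ℝ → ℝ} (hφ : ContinuousAt φ 0)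
    (h : ∀ ε : ℝ, 0 < ε → ε ≤ 1 → 0 ≤ φ ε) : 0 ≤ φ 0 := by
  have ht : Tendsto φ (𝓝[>] 0) (𝓝 (φ 0)) := hφ.tendsto.mono_left nhdsWithin_le_nhds
  refine ge_of_tendsto ht ?_
  have hmem : Ioo (0 : ℝ) 1 ∈ 𝓝[>] (0 : ℝ) := Ioo_mem_nhdsGT one_pos
  filter_upwards [hmem] with ε hε using h ε hε.1 hε.2.le

/-! ## 2. The viscous term at a real exponent -/

/-- **Sign of the viscous term of the `Z_q` balance at a real exponent.** For smooth `v` on `T^d`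
and `r > 0`:
`∫ (|ω|²)^r ∑ᵢⱼ WᵢⱼΔWᵢⱼ ≤ −∫ (|ω|²)^r ∑ₖ∑ᵢⱼ (∂ₖWᵢⱼ)²`
— the smooth-weight identity (Gibbon 2010, App. A step 1, tree
`integral_deriv_comp_mul_sum_mul_laplacian_torusVorticityTensor`) at `g_ε(s) = (s+ε)^{r+1}/(r+1)`,
whose second term `−∫ r(|ω|²+ε)^{r−1}∑ₖ(∂ₖ|ω|²)²` is nonpositive, and `ε → 0⁺`. [ours] -/
theorem integral_rpow_mul_sum_mul_laplacian_le {v : UnitAddTorus d → EuclideanSpace ℝ d}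
    (hv : IsSmooth v) {r : ℝ} (hr : 0 < r) :
    ∫ x, torusVorticitySqAt v x ^ r * ∑ i, ∑ j,
        torusVorticityTensor v i j x * Torus.laplacian (torusVorticityTensor v i j) x ≤
      -∫ x, torusVorticitySqAt v x ^ r * ∑ k, ∑ i, ∑ j,
          partialDeriv k (torusVorticityTensor v i j) x ^ 2 := by
  -- the two continuous densities
  have hW : ∀ i j, IsSmooth (torusVorticityTensor v i j) := fun i j =>
    ((hv.partialDeriv i).apply j).sub ((hv.partialDeriv j).apply i)
  have hQ : Continuous (torusVorticitySqAt v) := continuous_vorticitySqAt hv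
  have hQ0 : ∀ x, 0 ≤ torusVorticitySqAt v x := torusVorticitySqAt_nonneg v
  set h₁ : UnitAddTorus d → ℝ := fun x => ∑ i, ∑ j,
    torusVorticityTensor v i j x * Torus.laplacian (torusVorticityTensor v i j) x with hh₁
  set h₂ : UnitAddTorus d → ℝ := fun x => ∑ k, ∑ i, ∑ j,
    partialDeriv k (torusVorticityTensor v i j) x ^ 2 with hh₂
  have hc₁ : Continuous h₁ := continuous_finsetSum _ fun i _ => continuous_finsetSum _ fun j _ =>
    (hW i j).continuous.mul (hW i j).laplacian.continuous
  have hc₂ : Continuous h₂ := continuous_finsetSum _ fun k _ => continuous_finsetSum _ fun i _ =>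
    continuous_finsetSum _ fun j _ => ((hW i j).partialDeriv k).continuous.pow 2
  -- the parametric integrals
  set F : ℝ → ℝ := fun ε => ∫ x, (torusVorticitySqAt v x + ε) ^ r * h₁ x with hF
  set G : ℝ → ℝ := fun ε => ∫ x, (torusVorticitySqAt v x + ε) ^ r * h₂ x with hG
  have hpow : Continuous fun p : ℝ × UnitAddTorus d => (torusVorticitySqAt v p.2 + p.1) ^ r :=
    ((hQ.comp continuous_snd).add continuous_fst).rpow_const fun p => Or.inr hr.le
  have hFc : Continuous F := continuous_integral_param' (hpow.mul (hc₁.comp continuous_snd))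
  have hGc : Continuous G := continuous_integral_param' (hpow.mul (hc₂.comp continuous_snd))
  -- the identity at `ε > 0`
  have hε : ∀ ε : ℝ, 0 < ε → ε ≤ 1 → 0 ≤ -G ε - F ε := by
    intro ε hε _
    set g : ℝ → ℝ := fun s => (s + ε) ^ (r + 1) / (r + 1) with hg
    have hr1 : (1 : ℝ) ≤ r + 1 := by linarith
    have hr1' : r + 1 ≠ 0 := by linarith
    have hpos : ∀ x, 0 < torusVorticitySqAt v x + ε := fun x => by linarith [hQ0 x]
    have hU : IsOpen (Ioi (-ε)) := isOpen_Ioi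
    have hmaps : ∀ x, torusVorticitySqAt v x ∈ Ioi (-ε) := fun x => by
      show -ε < torusVorticitySqAt v x; linarith [hQ0 x]
    have hgs : ContDiffOn ℝ ∞ g (Ioi (-ε)) := by
      intro y hy
      have hy' : y + ε ≠ 0 := by
        have : -ε < y := hy
        linarith
      exact (((contDiffAt_id.add contDiffAt_const).rpow_const_of_ne hy').div_const _).contDiffWithinAt
    -- `g' = (s+ε)^r` everywhere, `g'' = r(s+ε)^{r-1}` on `Ioi (-ε)`
    have hd1 : deriv g = fun y => (y + ε) ^ r := by
      funext y
      have h := ((hasDerivAt_id' y).add_const ε).rpow_const (p := r + 1) (Or.inr hr1)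
      have h' : HasDerivAt g ((1 * (r + 1) * (y + ε) ^ (r + 1 - 1)) / (r + 1)) y := h.div_const _
      rw [h'.deriv, add_sub_cancel_right]
      field_simp
    have hd2 : ∀ y : ℝ, 0 < y + ε → deriv (deriv g) y = r * (y + ε) ^ (r - 1) := by
      intro y hy
      rw [hd1]
      have h := ((hasDerivAt_id' y).add_const ε).rpow_const (p := r) (Or.inl hy.ne')
      rw [h.deriv]; ring
    have hid := integral_deriv_comp_mul_sum_mul_laplacian_torusVorticityTensor hv hU hgs hmaps
    rw [hd1] at hid
    -- the second term is nonnegative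
    have hB : 0 ≤ ∫ x, deriv (fun y => (y + ε) ^ r) (torusVorticitySqAt v x) *
        ∑ k, partialDeriv k (torusVorticitySqAt v) x ^ 2 := by
      refine integral_nonneg fun x => ?_
      have e : deriv (fun y => (y + ε) ^ r) (torusVorticitySqAt v x) =
          r * (torusVorticitySqAt v x + ε) ^ (r - 1) := by
        have := hd2 (torusVorticitySqAt v x) (hpos x)
        rwa [hd1] at this
      rw [e]
      exact mul_nonneg (mul_nonneg hr.le (Real.rpow_nonneg (hpos x).le _))
        (Finset.sum_nonneg fun k _ => sq_nonneg _)
    have hFε : F ε = ∫ x, (torusVorticitySqAt v x + ε) ^ r * h₁ x := rfl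
    have hGε : G ε = ∫ x, (torusVorticitySqAt v x + ε) ^ r * h₂ x := rfl
    rw [hFε, hGε]
    simp only [hh₁, hh₂]
    linarith [hid, hB]
  -- `ε → 0⁺`
  have hφ : ContinuousAt (fun ε => -G ε - F ε) 0 := (hGc.neg.sub hFc).continuousAt
  have h0 := nonneg_of_forall_pos_of_continuousAt hφ hε
  have hF0 : F 0 = ∫ x, torusVorticitySqAt v x ^ r * h₁ x := by simp only [hF, add_zero]
  have hG0 : G 0 = ∫ x, torusVorticitySqAt v x ^ r * h₂ x := by simp only [hG, add_zero]
  simp only [hF0, hG0, hh₁, hh₂] at h0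
  linarith

/-! ## 3. The slice form of the `Z_q` balance on `T³` -/

/-- On `T³`, `(|ω|²)^r = ‖curl v‖^{2r}`. [folklore] -/
theorem vorticitySqAt_rpow_eq (v : UnitAddTorus (Fin 3) → EuclideanSpace ℝ (Fin 3))
    (x : UnitAddTorus (Fin 3)) (r : ℝ) :
    torusVorticitySqAt v x ^ r = ‖BDSV.curl v x‖ ^ (2 * r) := by
  rw [← norm_curl_sq, ← Real.rpow_natCast, ← Real.rpow_mul (norm_nonneg _)]
  norm_num

/-- On `T³`, the weighted viscous density in terms of `ω = curl v`:
`∫ (|ω|²)^r ∑ₖ∑ᵢⱼ(∂ₖWᵢⱼ)² = 2 ∫ ‖ω‖^{2r} ∑ₖ‖∂ₖω‖²`. [folklore] -/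
theorem viscous_rpow_term_eq {v : UnitAddTorus (Fin 3) → EuclideanSpace ℝ (Fin 3)}
    (hv : IsSmooth v) (r : ℝ) :
    ∫ x, torusVorticitySqAt v x ^ r *
        ∑ k, ∑ i, ∑ j, partialDeriv k (torusVorticityTensor v i j) x ^ 2 =
      2 * ∫ x, ‖BDSV.curl v x‖ ^ (2 * r) * ∑ k, ‖partialDeriv k (BDSV.curl v) x‖ ^ 2 := by
  rw [← integral_const_mul]
  refine integral_congr_ae (ae_of_all _ fun x => ?_)
  simp only [sum_partialDeriv_vorticityTensor_sq hv, vorticitySqAt_rpow_eq]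
  rw [← Finset.mul_sum]
  ring

/-- **Slice form of the `Z_q` balance on `T³`, real `q > 2`** (tree
`hasDerivWithinAt_integral_torusVorticitySqAt_rpow_unforced` + the viscous sign
`integral_rpow_mul_sum_mul_laplacian_le`): along a classical solution of the unforced system on
`[a, b] × T³` with `ν ≥ 0`, `s ↦ Z_q(s) = ∫(|ω(s)|²)^{q/2}` is differentiable within `[a, b]` at `t`
and `dZ_q/dt ≤ q∫(|ω|²)^{q/2−1}σ − qν∫‖ω‖^{q−2}∑ₖ‖∂ₖω‖²`, `ω = curl u(t)`.
[cite: Gibbon2010, Appendix A (proof of Prop. 1), opening identity and step 1] -/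
theorem derivWithin_Zq_le {a b ν : ℝ} (hab : a < b) (hν : 0 ≤ ν)
    {u : ℝ → UnitAddTorus (Fin 3) → EuclideanSpace ℝ (Fin 3)} {p : ℝ → UnitAddTorus (Fin 3) → ℝ}
    (hsol : IsClassicalNSSolutionOn (Icc a b) ν 0 u p) {q : ℝ} (hq : 2 < q) {t : ℝ}
    (ht : t ∈ Icc a b) :
    DifferentiableWithinAt ℝ (fun s => ∫ x, torusVorticitySqAt (u s) x ^ (q / 2)) (Icc a b) t ∧
      derivWithin (fun s => ∫ x, torusVorticitySqAt (u s) x ^ (q / 2)) (Icc a b) t ≤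
        q * (∫ x, torusVorticitySqAt (u t) x ^ (q / 2 - 1) * torusStretchingDensity (u t) x) -
          q * ν * ∫ x, ‖BDSV.curl (u t) x‖ ^ (q - 2) *
            ∑ k, ‖partialDeriv k (BDSV.curl (u t)) x‖ ^ 2 := by
  have hut : IsSmooth (u t) := hsol.smooth_velocity.isSmooth_slice ht
  have hD := hsol.hasDerivWithinAt_integral_torusVorticitySqAt_rpow_unforced hab hq.le ht
  have hUD : UniqueDiffWithinAt ℝ (Icc a b) t := uniqueDiffOn_Icc hab t ht
  refine ⟨hD.differentiableWithinAt, ?_⟩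
  rw [hD.derivWithin hUD]
  have hr : 0 < q / 2 - 1 := by linarith
  have hV := integral_rpow_mul_sum_mul_laplacian_le hut hr
  rw [viscous_rpow_term_eq hut, show 2 * (q / 2 - 1) = q - 2 by ring] at hV
  obtain ⟨I, hI⟩ : ∃ I : ℝ, I = ∫ x, ‖BDSV.curl (u t) x‖ ^ (q - 2) *
      ∑ k, ‖partialDeriv k (BDSV.curl (u t)) x‖ ^ 2 := ⟨_, rfl⟩
  obtain ⟨V, hVdef⟩ : ∃ V : ℝ, V = ∫ x, torusVorticitySqAt (u t) x ^ (q / 2 - 1) * ∑ i, ∑ j,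
      torusVorticityTensor (u t) i j x * Torus.laplacian (torusVorticityTensor (u t) i j) x :=
    ⟨_, rfl⟩
  rw [← hI, ← hVdef] at hV ⊢
  have hq0 : 0 ≤ q / 2 * ν := by positivity
  nlinarith [mul_le_mul_of_nonneg_left hV hq0]

end VorticityMoment

end Summit.NavierStokesRegularity.FunctionalMining
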